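import Literature.NumberTheory.DiophantineGeometry.DenesEquationFreyCurveTwoProofs
import Literature.NumberTheory.EllipticCurves.SzpiroOfAbcProofs
import Literature.NumberTheory.EllipticCurves.QuadraticTwist
import HarnessLib

/-!
# The `2`-part of the conductor of a Frey–Hellegouarch curve: `64 ∤ N(E_{a,b})` or `64 ∤ N(E_{b,a})`

Topic `Literature/NumberTheory/DiophantineGeometry`; a *proofs* file (theorems only: no definition,
no named fact, no `sorry`) assembling the tree's Diamond–Kramer computations of the conductor
exponent at `2` of the Frey curve `E_{A,B} : y² = x (x − A) (x + B)`
(`Literature.NumberTheory.EllipticCurves.freyCurve A B`) into a statement valid for **every**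
coprime pair `(a, b)` with `ab(a+b) ≠ 0` — in particular for the Frey–Hellegouarch curves of
Pasten, *Shimura curves and the abc conjecture* (arXiv:1705.09251), §3 p. 13, which carry **no
congruence normalisation** (`Literature.NumberTheory.Automorphic.IsFreyHellegouarch`).

Diamond–Kramer (Math. Res. Lett. 2 (1995); quoted in Ribet, Acta Arith. 79 (1997), §2, pp. 10–11:
"the conductor `N_E` of `E` has the form `2^t rad′(ABC)` … `t` is `5, 3, 3, 0` or `1` according as
`ord₂ (B)` is `1, 2, 3, 4`, or an integer greater than `4`") compute `t` for the normalised
presentation `A ≡ −1 (mod 4)`, `2 ∣ B`; the tree has these rows as theorems: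
`conductorExponent_freyCurve_two_of_two_dvd` (`ord₂ B = 1`, `t = 5`, no condition on `A mod 4`),
`conductorExponent_freyCurve_two_eq_three` (`ord₂ B ∈ {2, 3}`, `t = 3`),
`conductorNorm_freyCurve_dvd_radical_of_sixteen_dvd` (`16 ∣ B`, `t ≤ 1`).

A general coprime pair `(a, b)` need not admit such a presentation: the curve `E_{a,b}` has the six
presentations `E_{A,B}` obtained by moving one of its `2`-torsion points `(0,0), (a,0), (−b,0)` to
the origin (`translate_freyCurve`, a change of variables with `u = 1`, so the conductor is unchanged,
`WeierstrassCurve.conductorNorm_smul_rat`) and swapping the other two (`freyCurve_swap`, the same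
equation), and exactly one of `a`, `b`, `a + b` is even.  When that even number is `2 mod 4` the
row `t = 5` applies to `E_{a,b}` directly.  When it is divisible by `4`, the two presentations with
`B` even have the *same* `A mod 4`; if `A ≡ −1 (mod 4)` the rows `t ∈ {3, 0, 1}` apply ("good
sign"), and otherwise ("bad sign": e.g. `E_{1,4}` of conductor `80 = 2⁴·5`, `E_{3,1}` of conductor
`48`, `E_{1,16}` of conductor `272 = 2⁴·17`, all of type `Iₙ*` with `t = 4`) the **quadratic twist by
`−1`**, which is `E_{b,a}` on the nose (`quadraticTwist_freyCurve_neg_one`: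
`E_{a,b}^{(−1)} : −y² = x(x−a)(x+b)`, `x ↦ −x`), is good-sign.  Hence the dichotomy
`factorization_two_conductorNorm_freyCurve_le_five_or_swap_le_three`:

  `ord₂ N(E_{a,b}) ≤ 5` or `ord₂ N(E_{b,a}) ≤ 3`   (`a, b` coprime, `ab(a+b) ≠ 0`),

and `not_sixtyfour_dvd_conductorNorm_freyCurve_or_swap`.  (The bad-sign values `t = 4` themselves
— types `I₀*`, `I₂*`, `I*_{2k−4}` — are not computed here; they are not needed by the consumer,
the twist-descent form of Mai–Murty's Petersson bound in
`Literature/NumberTheory/Automorphic/ShimuraCurveRibetTakahashiPeterssonFreyHellegouarchProofs`.)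
The values agree with PARI's `ellglobalred` on all coprime `1 ≤ a, b ≤ 79` (this seat's census
`j017118`: `t ∈ {0, 1, 3, 4, 5}`, and `t = 4` exactly in the bad-sign classes).

## References

* [DiamondKramer1995] F. Diamond, K. Kramer, *Modularity of a family of elliptic curves*, Math.
  Res. Lett. 2 (1995), 299–304 (the `2`-adic table).
* [Ribet1997] K. A. Ribet, *On the equation `a^p + 2^α b^p + c^p = 0`*, Acta Arith. 79 (1997), §2,
  pp. 10–11 (the table as quoted).
* [PastenShimura2024] H. Pasten, *Shimura curves and the abc conjecture*, J. Number Theory (2024) /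
  arXiv:1705.09251, §3 p. 13 (Frey–Hellegouarch curves without congruence conditions).
* [SilvermanAEC2009] J. H. Silverman, *The Arithmetic of Elliptic Curves*, 2nd ed., III.1 Table 3.1
  (changes of variables), X.2 (quadratic twists).
-/

noncomputable section

open IsDedekindDomain WeierstrassCurve UniqueFactorizationMonoid Rat.HeightOneSpectrum
open Literature.NumberTheory.EllipticCurves

namespace Literature.NumberTheory.DiophantineGeometry

/-! ### The six presentations of `E_{a,b}` and its twist by `−1` -/

section Presentations

variable (A B : ℤ)

/-- **Swapping the two non-zero roots is the same equation**: `E_{B,A} = E_{−A,−B}`, i.e.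
`x (x − B) (x + A) = x (x − (−A)) (x + (−B))` (both have `a₂ = A − B`, `a₄ = −AB`). [folklore] -/
theorem freyCurve_swap : freyCurve B A = freyCurve (-A) (-B) := by
  ext
  · rfl
  · simp only [freyCurve_a₂, Int.cast_neg]; ring
  · rfl
  · simp only [freyCurve_a₄, Int.cast_neg]; ring
  · rfl

/-- **Moving the `2`-torsion point `(A, 0)` to the origin**: the translation `x ↦ x + A`
(`(u, r, s, t) = (1, A, 0, 0)`, Silverman *AEC* III.1 Table 3.1) carries `E_{A,B} : y² = x(x−A)(x+B)`
to `y² = x (x + A) (x + A + B) = E_{−A, A+B}`. [cite: SilvermanAEC2009, III.1 Table 3.1] -/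
theorem translate_freyCurve :
    (⟨1, (A : ℚ), 0, 0⟩ : VariableChange ℚ) • freyCurve A B = freyCurve (-A) (A + B) := by
  ext
  · simp only [variableChange_a₁, freyCurve_a₁, Units.val_one, inv_one]; ring
  · simp only [variableChange_a₂, freyCurve_a₁, freyCurve_a₂, Units.val_one, inv_one, Int.cast_neg,
      Int.cast_add]; ring
  · simp only [variableChange_a₃, freyCurve_a₁, freyCurve_a₃, Units.val_one, inv_one]; ring
  · simp only [variableChange_a₄, freyCurve_a₁, freyCurve_a₂, freyCurve_a₃, freyCurve_a₄,
      Units.val_one, inv_one, Int.cast_neg, Int.cast_add]; ring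
  · simp only [variableChange_a₆, freyCurve_a₁, freyCurve_a₂, freyCurve_a₃, freyCurve_a₄,
      freyCurve_a₆, Units.val_one, inv_one]; ring

/-- **The quadratic twist of `E_{A,B}` by `−1` is `E_{B,A}`, as an equation**: with the tree's
completed-square twist `W^{(d)} = (0, d b₂/4, 0, d² b₄/2, d³ b₆/4)` (`WeierstrassCurve.quadraticTwist`,
Silverman *AEC* X.2) and `b₂ = 4 (B − A)`, `b₄ = −2AB`, `b₆ = 0` one gets `(0, A − B, 0, −AB, 0)`,
i.e. `y² = x (x − B) (x + A)` (`−y² = x(x−A)(x+B)` after `x ↦ −x`). [cite: SilvermanAEC2009, X.2 Prop. 2.4] -/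
theorem quadraticTwist_freyCurve_neg_one : (freyCurve A B).quadraticTwist (-1) = freyCurve B A := by
  ext
  · rfl
  · simp only [quadraticTwist_a₂, WeierstrassCurve.b₂, freyCurve_a₁, freyCurve_a₂]; ring
  · rfl
  · simp only [quadraticTwist_a₄, WeierstrassCurve.b₄, freyCurve_a₁, freyCurve_a₃, freyCurve_a₄]
    ring
  · simp only [quadraticTwist_a₆, WeierstrassCurve.b₆, freyCurve_a₃, freyCurve_a₆]; ring

variable {A B}

/-- The conductor of `E_{A,B}` equals that of its presentation `E_{−A, A+B}` (translation by a
`2`-torsion point; `N` is an isomorphism invariant, `conductorNorm_smul_rat`). [folklore] -/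
theorem conductorNorm_freyCurve_translate (h0 : A * B * (A + B) ≠ 0) :
    (freyCurve (-A) (A + B)).conductorNorm ℤ = (freyCurve A B).conductorNorm ℤ := by
  haveI := isElliptic_freyCurve h0
  rw [← translate_freyCurve, conductorNorm_smul_rat]

end Presentations

/-! ### The rows of Diamond–Kramer's table, read on `ord₂ N(E_{A,B})` -/

section Rows

variable {A B : ℤ}

/-- `ord₂ (N_E) = f₂`, the conductor exponent at the place `primesEquiv.symm 2` of `ℤ`
(`factorization_conductorNorm_primesEquiv_symm`). [folklore] -/
theorem factorization_two_conductorNorm (W : WeierstrassCurve ℚ) [W.IsElliptic] :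
    (W.conductorNorm ℤ).factorization 2 =
      W.conductorExponent ((primesEquiv (R := ℤ)).symm ⟨2, Nat.prime_two⟩) :=
  factorization_conductorNorm_primesEquiv_symm W ⟨2, Nat.prime_two⟩

/-- **Row `ord₂ B = 1`: `ord₂ N(E_{A,B}) = 5`** for `A` odd and `2 ∥ B` (type `III`; Diamond–Kramer,
as quoted by Ribet 1997 §2 p. 11; the tree's `conductorExponent_freyCurve_two_of_two_dvd`, which needs no
condition on `A mod 4`). [cite: Ribet1997, §2, p. 11] [cite: DiamondKramer1995] -/
theorem factorization_two_conductorNorm_freyCurve_of_not_four_dvd (h0 : A * B * (A + B) ≠ 0)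
    (hA : ¬ (2 : ℤ) ∣ A) (hB : (2 : ℤ) ∣ B) (hB4 : ¬ (4 : ℤ) ∣ B) :
    ((freyCurve A B).conductorNorm ℤ).factorization 2 = 5 := by
  haveI := isElliptic_freyCurve h0
  obtain ⟨b, hb⟩ := hB
  have hbodd : ¬ (2 : ℤ) ∣ b := fun ⟨c, hc⟩ ↦ hB4 ⟨c, by rw [hb, hc]; ring⟩
  rw [factorization_two_conductorNorm]
  exact conductorExponent_freyCurve_two_of_two_dvd _
    (Literature.NumberTheory.EllipticCurves.Rat.natGenerator_primesEquiv_symm ⟨2, Nat.prime_two⟩)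
    h0 hA hb hbodd

/-- **Rows `ord₂ B ∈ {2, 3}`: `ord₂ N(E_{A,B}) = 3`** for `A ≡ −1 (mod 4)`, `4 ∣ B`, `16 ∤ B`
(types `I₁*`, `III*`; the tree's `conductorExponent_freyCurve_two_eq_three`).
[cite: Ribet1997, §2, pp. 10–11] [cite: DiamondKramer1995] -/
theorem factorization_two_conductorNorm_freyCurve_of_four_dvd (h0 : A * B * (A + B) ≠ 0)
    (hA : A ≡ -1 [ZMOD 4]) (h4 : (4 : ℤ) ∣ B) (h16 : ¬ (16 : ℤ) ∣ B) :
    ((freyCurve A B).conductorNorm ℤ).factorization 2 = 3 := by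
  haveI := isElliptic_freyCurve h0
  rw [factorization_two_conductorNorm]
  exact conductorExponent_freyCurve_two_eq_three _
    (Literature.NumberTheory.EllipticCurves.Rat.natGenerator_primesEquiv_symm ⟨2, Nat.prime_two⟩)
    h0 hA h4 h16

/-- **Good sign, `4 ∣ B`: `ord₂ N(E_{A,B}) ≤ 3`** (`A, B` coprime, `A ≡ −1 (mod 4)`): the rows
`ord₂ B = 2, 3` give `3`; the rows `ord₂ B ≥ 4` give `≤ 1` (semistable at `2`: `N_E ∣ rad (AB(A+B))`,
the tree's `conductorNorm_freyCurve_dvd_radical_of_sixteen_dvd`, the radical being squarefree — as in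
`factorization_conductorNorm_freyCurve_two_le_one` of `GeneralizedFermatTwoPowerCoefficientSerreProofs`,
whose three lines are repeated inline to keep this file's imports light). [cite: Ribet1997, §2, pp. 10–11]
[cite: DiamondKramer1995] -/
theorem factorization_two_conductorNorm_freyCurve_le_three (hAB : IsCoprime A B)
    (h0 : A * B * (A + B) ≠ 0) (hA : A ≡ -1 [ZMOD 4]) (h4 : (4 : ℤ) ∣ B) :
    ((freyCurve A B).conductorNorm ℤ).factorization 2 ≤ 3 := by
  haveI := isElliptic_freyCurve h0
  by_cases h16 : (16 : ℤ) ∣ B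
  · have hdvd := conductorNorm_freyCurve_dvd_radical_of_sixteen_dvd hAB h0 hA h16
    have hle := (Nat.factorization_le_iff_dvd (conductorNorm_pos_holds (freyCurve A B)).ne'
      radical_ne_zero).mpr hdvd
    exact ((hle 2).trans (squarefree_radical.natFactorization_le_one 2)).trans (by norm_num)
  · exact (factorization_two_conductorNorm_freyCurve_of_four_dvd h0 hA h4 h16).le

/-- **Good sign: `ord₂ N(E_{A,B}) ≤ 5`** for `A, B` coprime, `A ≡ −1 (mod 4)`, `B` even (all rows of
Diamond–Kramer's table). [cite: Ribet1997, §2, pp. 10–11] [cite: DiamondKramer1995] -/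
theorem factorization_two_conductorNorm_freyCurve_le_five (hAB : IsCoprime A B)
    (h0 : A * B * (A + B) ≠ 0) (hA : A ≡ -1 [ZMOD 4]) (hB : (2 : ℤ) ∣ B) :
    ((freyCurve A B).conductorNorm ℤ).factorization 2 ≤ 5 := by
  by_cases h4 : (4 : ℤ) ∣ B
  · exact (factorization_two_conductorNorm_freyCurve_le_three hAB h0 hA h4).trans (by norm_num)
  · have hA2 : ¬ (2 : ℤ) ∣ A := by
      intro h2
      have h := hA.dvd  -- `4 ∣ -1 - A`
      omega
    exact (factorization_two_conductorNorm_freyCurve_of_not_four_dvd h0 hA2 hB h4).le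

end Rows

/-! ### The dichotomy for an arbitrary coprime pair -/

section Dichotomy

variable {a b : ℤ}

/-- Coprime integers are not both even. [folklore] -/
theorem not_two_dvd_and_two_dvd_of_isCoprime (hab : IsCoprime a b) : ¬ ((2 : ℤ) ∣ a ∧ (2 : ℤ) ∣ b) := by
  rintro ⟨ha, hb⟩
  have h := Int.isUnit_iff.mp (hab.isUnit_of_dvd' ha hb)
  omega

/-- **The `2`-adic dichotomy for Frey–Hellegouarch curves.** For coprime integers `a, b` with
`ab(a+b) ≠ 0`: either `ord₂ N(E_{a,b}) ≤ 5`, or `ord₂ N(E_{b,a}) ≤ 3` — where `E_{b,a} = E_{a,b}^{(−1)}`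
(`quadraticTwist_freyCurve_neg_one`).  Proof: exactly one of `a, b, a+b` is even; present `E_{a,b}`
(or `E_{b,a}`) as `E_{A,B}` with `B` that even number up to sign (`freyCurve_swap`,
`translate_freyCurve`); if `4 ∤ B` the row `t = 5` applies to `E_{a,b}`; if `4 ∣ B` then `A` is
`−1 mod 4` for `E_{a,b}` or for `E_{b,a}` (the odd roots of the two curves differ by a sign), and the
rows `t ∈ {3, 0, 1}` apply to that curve. (Diamond–Kramer's table, Ribet 1997 §2 pp. 10–11, applied to
the un-normalised Frey–Hellegouarch curves of Pasten §3 p. 13.) [cite: Ribet1997, §2, pp. 10–11]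
[cite: DiamondKramer1995] [cite: PastenShimura2024, §3 p. 13] -/
theorem factorization_two_conductorNorm_freyCurve_le_five_or_swap_le_three (hab : IsCoprime a b)
    (h0 : a * b * (a + b) ≠ 0) :
    ((freyCurve a b).conductorNorm ℤ).factorization 2 ≤ 5 ∨
      ((freyCurve b a).conductorNorm ℤ).factorization 2 ≤ 3 := by
  have h0' : b * a * (b + a) ≠ 0 := by
    have : b * a * (b + a) = a * b * (a + b) := by ring
    rwa [this]
  have hnot := not_two_dvd_and_two_dvd_of_isCoprime hab
  by_cases hb : (2 : ℤ) ∣ b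
  · -- `b` even, `a` odd: presentation `(A, B) = (a, b)`; the swap is `E_{−a,−b}`
    have ha : ¬ (2 : ℤ) ∣ a := fun ha ↦ hnot ⟨ha, hb⟩
    by_cases h4 : (4 : ℤ) ∣ b
    · by_cases hA : a ≡ -1 [ZMOD 4]
      · exact Or.inl (factorization_two_conductorNorm_freyCurve_le_five hab h0 hA hb)
      · right
        have hA' : (-a) ≡ -1 [ZMOD 4] := by
          unfold Int.ModEq at hA ⊢
          omega
        have hneg0 : (-a) * (-b) * (-a + -b) ≠ 0 := by
          have : (-a) * (-b) * (-a + -b) = -(a * b * (a + b)) := by ring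
          rw [this]; exact neg_ne_zero.mpr h0
        rw [freyCurve_swap]
        exact factorization_two_conductorNorm_freyCurve_le_three hab.neg_neg hneg0 hA'
          ((dvd_neg).mpr h4)
    · exact Or.inl (factorization_two_conductorNorm_freyCurve_of_not_four_dvd h0 ha hb h4).le
  · by_cases ha : (2 : ℤ) ∣ a
    · -- `a` even, `b` odd: presentation `E_{a,b} = E_{−b,−a}`; the swap is `E_{b,a}` itself
      have hneg0 : (-b) * (-a) * (-b + -a) ≠ 0 := by
        have : (-b) * (-a) * (-b + -a) = -(a * b * (a + b)) := by ring
        rw [this]; exact neg_ne_zero.mpr h0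
      by_cases h4 : (4 : ℤ) ∣ a
      · by_cases hB : b ≡ -1 [ZMOD 4]
        · exact Or.inr (factorization_two_conductorNorm_freyCurve_le_three hab.symm h0' hB h4)
        · left
          have hB' : (-b) ≡ -1 [ZMOD 4] := by
            unfold Int.ModEq at hB ⊢
            omega
          rw [freyCurve_swap]
          exact (factorization_two_conductorNorm_freyCurve_le_three hab.symm.neg_neg hneg0 hB'
            ((dvd_neg).mpr h4)).trans (by norm_num)
      · left
        rw [freyCurve_swap]
        exact (factorization_two_conductorNorm_freyCurve_of_not_four_dvd hneg0
          (fun h ↦ hb ((dvd_neg).mp h)) ((dvd_neg).mpr ha) (fun h ↦ h4 ((dvd_neg).mp h))).le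
    · -- `a`, `b` odd, `a + b` even: presentations `E_{−a, a+b}` of `E_{a,b}`, `E_{−b, b+a}` of `E_{b,a}`
      have hab2 : (2 : ℤ) ∣ a + b := by omega
      have hnegA : (-a) * (a + b) * (-a + (a + b)) ≠ 0 := by
        have : (-a) * (a + b) * (-a + (a + b)) = -(a * b * (a + b)) := by ring
        rw [this]; exact neg_ne_zero.mpr h0
      have hnegB : (-b) * (b + a) * (-b + (b + a)) ≠ 0 := by
        have : (-b) * (b + a) * (-b + (b + a)) = -(a * b * (a + b)) := by ring
        rw [this]; exact neg_ne_zero.mpr h0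
      have hcopA : IsCoprime (-a) (a + b) := by
        have h := (hab.add_mul_left_right 1).neg_left
        rwa [mul_one, add_comm] at h
      by_cases h4 : (4 : ℤ) ∣ a + b
      · by_cases hA : (-a) ≡ -1 [ZMOD 4]
        · left
          rw [← conductorNorm_freyCurve_translate h0]
          exact (factorization_two_conductorNorm_freyCurve_le_three hcopA hnegA hA h4).trans
            (by norm_num)
        · right
          have hB' : (-b) ≡ -1 [ZMOD 4] := by
            unfold Int.ModEq at hA ⊢
            omega
          have hcopB : IsCoprime (-b) (b + a) := by
            have h := (hab.symm.add_mul_left_right 1).neg_left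
            rwa [mul_one, add_comm] at h
          rw [← conductorNorm_freyCurve_translate h0']
          exact factorization_two_conductorNorm_freyCurve_le_three hcopB hnegB hB'
            (by rw [add_comm]; exact h4)
      · left
        rw [← conductorNorm_freyCurve_translate h0]
        exact (factorization_two_conductorNorm_freyCurve_of_not_four_dvd hnegA
          (fun h ↦ ha ((dvd_neg).mp h)) hab2 h4).le

/-- `2⁶ ∤ n` when `ord₂ n ≤ 5` and `n ≠ 0`. [folklore] -/
theorem not_sixtyfour_dvd_of_factorization_le {n : ℕ} (hn : n ≠ 0) (h : n.factorization 2 ≤ 5) :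
    ¬ 64 ∣ n := by
  intro h64
  have h6 : 6 ≤ n.factorization 2 :=
    (Nat.prime_two.pow_dvd_iff_le_factorization hn).mp (by simpa using h64)
  omega

/-- **`64 ∤ N(E_{a,b})` or `64 ∤ N(E_{b,a})`** for coprime `a, b` with `ab(a+b) ≠ 0`
(`factorization_two_conductorNorm_freyCurve_le_five_or_swap_le_three`). [cite: Ribet1997, §2, pp. 10–11]
[cite: DiamondKramer1995] -/
theorem not_sixtyfour_dvd_conductorNorm_freyCurve_or_swap (hab : IsCoprime a b)
    (h0 : a * b * (a + b) ≠ 0) :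
    ¬ 64 ∣ (freyCurve a b).conductorNorm ℤ ∨ ¬ 64 ∣ (freyCurve b a).conductorNorm ℤ := by
  haveI := isElliptic_freyCurve h0
  have h0' : b * a * (b + a) ≠ 0 := by
    have : b * a * (b + a) = a * b * (a + b) := by ring
    rwa [this]
  haveI := isElliptic_freyCurve h0'
  rcases factorization_two_conductorNorm_freyCurve_le_five_or_swap_le_three hab h0 with h | h
  · exact Or.inl (not_sixtyfour_dvd_of_factorization_le (conductorNorm_pos_holds _).ne' h)
  · exact Or.inr (not_sixtyfour_dvd_of_factorization_le (conductorNorm_pos_holds _).ne'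
      (h.trans (by norm_num)))

/-- The same with the twist written as a twist: **`64 ∤ N(E_{a,b})` or `64 ∤ N(E_{a,b}^{(−1)})`**.
[cite: Ribet1997, §2, pp. 10–11] [cite: DiamondKramer1995] -/
theorem not_sixtyfour_dvd_conductorNorm_freyCurve_or_quadraticTwist_neg_one (hab : IsCoprime a b)
    (h0 : a * b * (a + b) ≠ 0) :
    ¬ 64 ∣ (freyCurve a b).conductorNorm ℤ ∨
      ¬ 64 ∣ ((freyCurve a b).quadraticTwist (-1)).conductorNorm ℤ := by
  rw [quadraticTwist_freyCurve_neg_one]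
  exact not_sixtyfour_dvd_conductorNorm_freyCurve_or_swap hab h0

end Dichotomy

end Literature.NumberTheory.DiophantineGeometry
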